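import Summits.KontsevichZagierPeriods.KontsevichZagierPeriods.Theorems.BiellipticRealPeriodCell.Negative.Witnesses

/-!
# `BiellipticRealPeriodCell` (stmt-KontsevichZagierPeriods-18685) — negative knowledge, part 2: load-bearing moves and refuted strengthenings

Support file for the crux `IsogenyCertificates.BiellipticRealPeriodCell` (cdisprove seat, cycle 1;
work file `Cruxes/BiellipticRealPeriodCell/Disproof.lean`), over part 1 (`Witnesses`: the honest
generators `r₊ = [K₊, 1/√F₀]`, `r₋ = [K₋, 1/√F₀]`, `r₀ = [K₀, x/√F₀]` on `y² = −(x²−1)(x²−4)(x²−9)`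
exist, with values `∫₂³ dx/√F₀ > 0`, the same, and `0`).

* §6 the witnesses are GENERATORS of the crux's sector (the generating set is the crux's, verbatim),
  so the sector is non-vacuous with content (`exists_generator_value_pos`), and the LOAD-BEARING
  INGREDIENTS, each the crux VERBATIM with one ingredient removed:
  `false_without_eval` (drop `eval c = 0`: `[K₊, 1/√F₀]` is not a relation, by soundness);
  `false_without_additivity` (relations generated by rules (2)+(3) only: the single generator `[r₀]`
  has value `0` but coefficient sum `1`, `KZ.coeffSum` kills (2)+(3) — ANY PROOF MUST USE AN
  ADDITIVITY RULE, and specifically on the through-zero ovals);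
  `false_without_cov_nl` (relations generated by rules (1a)+(1b) only: the mirror pair `[r₊] − [r₋]`
  has value `0` but restricted value `−∫₂³ dx/√F₀ ≠ 0` over the window `{x < 0}`, `KZ.restrictedEval`
  kills (1a)+(1b) — ANY PROOF MUST MOVE MASS ACROSS `x = 0`, i.e. use rule (2) or (3));
* §7 REFUTED NATURAL STRENGTHENINGS: `not_value_ne_zero_of_nondegenerate` (a generator with
  `(a₀,a₁) ≠ (0,0)` CAN have value `0`: single generators lie in the kernel, which is therefore not
  spanned by differences of generators of equal value); `exists_kernel_single_ne_zero`,
  `exists_kernel_pair_ne_zero` (the sector's value-`0` subgroup is non-trivial in both shapes the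
  lines must digest: the odd central generator — dissection at `0`, reflection, recombination to a
  zero integrand — and the mirror pair — one reflection move, outside the additive sub-calculus).

The sector hypotheses themselves (`IsBounded`, `Squarefree`, `natDegree = 3`, `0 < G(q²)`) are NOT
truth-load-bearing: every weakening is implied by Conjecture 1 (`Negative/Core.lean`,
`biellGens_subset_without*`); they are method-bearing only. No statement of the tree is changed and no
definition is introduced. [Kontsevich–Zagier 2001, §1.2] [folklore]
-/

noncomputable section

open Set MeasureTheory MvPolynomial
open Literature.NumberTheory.Transcendental Literature.ModelTheory.ExponentialFields
open Summit.KontsevichZagierPeriods.KontsevichZagierPeriods.Theses.IsogenyCertificates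

namespace Summit.KontsevichZagierPeriods.IsogenyCertificates.BiellipticRealPeriodCellNegative

/-! ### §6 The witnesses are sector generators; load-bearing ingredients of the crux -/

/-- **`r₊` is a generator of the bielliptic sector** (`G = G₀`, `q = 5/2`, `a₀ = 1`, `a₁ = 0`); the
set is the crux's generating set verbatim. [cite: KontsevichZagier2001, §1.2] -/
theorem of_mem_right {r : KZ.IntegralRep 1} (hd : r.domain = {p | p 0 ∈ Ioo (2:ℝ) 3})
    (hi : r.integrand = fun p => 1 / Real.sqrt (-((p 0 ^ 2 - 1) * (p 0 ^ 2 - 4) * (p 0 ^ 2 - 9)))) : KZ.of r ∈ {d : KZ.FormalRep | ∃ (G : Polynomial ℚ) (q a₀ a₁ : ℚ) (r : KZ.IntegralRep 1), G.natDegree = 3 ∧ Squarefree (G.comp (Polynomial.X ^ 2)) ∧ 0 < Polynomial.aeval (q : ℝ) (G.comp (Polynomial.X ^ 2)) ∧ Bornology.IsBounded (connectedComponentIn {y : ℝ | 0 < Polynomial.aeval y (G.comp (Polynomial.X ^ 2))} (q : ℝ)) ∧ r.domain = {x | x 0 ∈ connectedComponentIn {y : ℝ | 0 < Polynomial.aeval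 y (G.comp (Polynomial.X ^ 2))} (q : ℝ)} ∧ Set.EqOn r.integrand (fun x => ((a₀ : ℝ) + (a₁ : ℝ) * x 0) / Real.sqrt (Polynomial.aeval (x 0) (G.comp (Polynomial.X ^ 2)))) r.domain ∧ d = KZ.of r} := by
  refine ⟨(Polynomial.C (-1) * Polynomial.X ^ 3 + Polynomial.C 14 * Polynomial.X ^ 2 + Polynomial.C (-49) * Polynomial.X + Polynomial.C 36 : Polynomial ℚ), 5/2, 1, 0, r, natDegree_G₀, squarefree_comp_G₀, ?_, isBounded_component_right, ?_, ?_, rfl⟩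
  · rw [aeval_F₀]; norm_num
  · rw [component_right, hd]
  · intro x _
    simp only [aeval_F₀, hi]
    simp

/-- **`r₋` is a generator of the bielliptic sector** (`G = G₀`, `q = −5/2`, `a₀ = 1`, `a₁ = 0`).
[cite: KontsevichZagier2001, §1.2] -/
theorem of_mem_left {r : KZ.IntegralRep 1} (hd : r.domain = {p | p 0 ∈ Ioo (-3:ℝ) (-2)})
    (hi : r.integrand = fun p => 1 / Real.sqrt (-((p 0 ^ 2 - 1) * (p 0 ^ 2 - 4) * (p 0 ^ 2 - 9)))) : KZ.of r ∈ {d : KZ.FormalRep | ∃ (G : Polynomial ℚ) (q a₀ a₁ : ℚ) (r : KZ.IntegralRep 1), G.natDegree = 3 ∧ Squarefree (G.comp (Polynomial.X ^ 2)) ∧ 0 < Polynomial.aeval (q : ℝ) (G.comp (Polynomial.X ^ 2)) ∧ Bornology.IsBounded (connectedComponentIn {y : ℝ | 0 < Polynomial.aeval y (G.comp (Polynomial.X ^ 2))} (q : ℝ)) ∧ r.domain = {x | x 0 ∈ connectedComponentIn {y : ℝ | 0 < Polynomial.aeval y (G.comp (Polynomial.X ^ 2))} (q : ℝ)} ∧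 Set.EqOn r.integrand (fun x => ((a₀ : ℝ) + (a₁ : ℝ) * x 0) / Real.sqrt (Polynomial.aeval (x 0) (G.comp (Polynomial.X ^ 2)))) r.domain ∧ d = KZ.of r} := by
  refine ⟨(Polynomial.C (-1) * Polynomial.X ^ 3 + Polynomial.C 14 * Polynomial.X ^ 2 + Polynomial.C (-49) * Polynomial.X + Polynomial.C 36 : Polynomial ℚ), -5/2, 1, 0, r, natDegree_G₀, squarefree_comp_G₀, ?_, isBounded_component_left, ?_, ?_, rfl⟩
  · rw [aeval_F₀]; norm_num
  · rw [component_left, hd]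
  · intro x _
    simp only [aeval_F₀, hi]
    simp

/-- **`r₀` is a generator of the bielliptic sector** (`G = G₀`, `q = 0`, `a₀ = 0`, `a₁ = 1`).
[cite: KontsevichZagier2001, §1.2] -/
theorem of_mem_central {r : KZ.IntegralRep 1} (hd : r.domain = {p | p 0 ∈ Ioo (-1:ℝ) 1})
    (hi : r.integrand = fun p => p 0 / Real.sqrt (-((p 0 ^ 2 - 1) * (p 0 ^ 2 - 4) * (p 0 ^ 2 - 9)))) : KZ.of r ∈ {d : KZ.FormalRep | ∃ (G : Polynomial ℚ) (q a₀ a₁ : ℚ) (r : KZ.IntegralRep 1), G.natDegree = 3 ∧ Squarefree (G.comp (Polynomial.X ^ 2)) ∧ 0 < Polynomial.aeval (q : ℝ) (G.comp (Polynomial.X ^ 2)) ∧ Bornology.IsBounded (connectedComponentIn {y : ℝ | 0 < Polynomial.aeval y (G.comp (Polynomial.X ^ 2))} (q : ℝ)) ∧ r.domain = {x | x 0 ∈ connectedComponentIn {y : ℝ | 0 < Polynomial.aeval y (G.comp (Polynomial.X ^ 2))} (q : ℝ)} ∧ Set.EqOn r.integrand (fun x => ((a₀ : ℝ) + (a₁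 : ℝ) * x 0) / Real.sqrt (Polynomial.aeval (x 0) (G.comp (Polynomial.X ^ 2)))) r.domain ∧ d = KZ.of r} := by
  refine ⟨(Polynomial.C (-1) * Polynomial.X ^ 3 + Polynomial.C 14 * Polynomial.X ^ 2 + Polynomial.C (-49) * Polynomial.X + Polynomial.C 36 : Polynomial ℚ), 0, 0, 1, r, natDegree_G₀, squarefree_comp_G₀, ?_, isBounded_component_central, ?_, ?_, rfl⟩
  · rw [aeval_F₀]; norm_num
  · rw [component_central, hd]
  · intro x _
    simp only [aeval_F₀, hi]
    simp

/-- **Non-vacuity with content**: the sector has a generator of POSITIVE value. [cite: KontsevichZagier2001, §1.2] -/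
theorem exists_generator_value_pos : ∃ r : KZ.IntegralRep 1, KZ.of r ∈ {d : KZ.FormalRep | ∃ (G : Polynomial ℚ) (q a₀ a₁ : ℚ) (r : KZ.IntegralRep 1), G.natDegree = 3 ∧ Squarefree (G.comp (Polynomial.X ^ 2)) ∧ 0 < Polynomial.aeval (q : ℝ) (G.comp (Polynomial.X ^ 2)) ∧ Bornology.IsBounded (connectedComponentIn {y : ℝ | 0 < Polynomial.aeval y (G.comp (Polynomial.X ^ 2))} (q : ℝ)) ∧ r.domain = {x | x 0 ∈ connectedComponentIn {y : ℝ | 0 < Polynomial.aeval y (G.comp (Polynomial.X ^ 2))} (q : ℝ)} ∧ Set.EqOn r.integrand (fun x => ((a₀ : ℝ) + (a₁ : ℝ) * x 0) / Real.sqrt (Polynomial.aeval (x 0) (G.comp (Polynomial.X ^ 2)))) r.domain ∧ d = KZ.of r} ∧ 0 < r.value := by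
  obtain ⟨r, hd, hi⟩ := exists_repRight
  exact ⟨r, of_mem_right hd hi, (value_right hd hi).symm ▸ integral_right_pos⟩

/-- **The hypothesis `eval c = 0` is load-bearing**: the crux with it deleted ("every element of the
bielliptic sector is a relation") is FALSE — `[K₊, 1/√F₀]` has value `∫₂³ dx/√F₀ > 0` while relations
evaluate to `0` (`KZ.relations_le_ker_eval_holds`). [cite: KontsevichZagier2001, §1.2] -/
theorem false_without_eval : ¬ (∀ c ∈ AddSubgroup.closure {d : KZ.FormalRep | ∃ (G : Polynomial ℚ) (q a₀ a₁ : ℚ) (r : KZ.IntegralRep 1), G.natDegree = 3 ∧ Squarefree (G.comp (Polynomial.X ^ 2)) ∧ 0 < Polynomial.aeval (q : ℝ) (G.comp (Polynomial.X ^ 2)) ∧ Bornology.IsBounded (connectedComponentIn {y : ℝ | 0 < Polynomial.aeval y (G.comp (Polynomial.X ^ 2))} (q : ℝ)) ∧ r.domain = {x | x 0 ∈ connectedComponentIn {y : ℝ | 0 < Polynomial.aeval y (G.comp (Polynomial.X ^ 2))} (q : ℝ)} ∧ Set.EqOn r.integrand (fun x => ((a₀ : ℝ) + (a₁ : ℝ)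 * x 0) / Real.sqrt (Polynomial.aeval (x 0) (G.comp (Polynomial.X ^ 2)))) r.domain ∧ d = KZ.of r}, c ∈ KZ.relations) := fun h => by
  obtain ⟨r, hd, hi⟩ := exists_repRight
  have hmem := h _ (AddSubgroup.subset_closure (of_mem_right hd hi))
  have h0 : KZ.eval (KZ.of r) = 0 := AddMonoidHom.mem_ker.1 (KZ.relations_le_ker_eval_holds hmem)
  rw [KZ.eval_of, value_right hd hi] at h0
  exact integral_right_pos.ne' h0

/-- **Any proof must use an additivity rule, (1a) or (1b).** The crux with `KZ.relations` replaced by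
the subgroup generated by rules (2) + (3) alone is FALSE: the SINGLE generator `[r₀] = [K₀, x/√F₀]`
has value `0` (odd integrand), but its coefficient sum is `1`, and `KZ.coeffSum` kills every
change-of-variables and Newton–Leibniz move (`KZ.closure_cov_nl_le_ker_coeffSum`). So the odd part
on a through-zero oval — the case the crux's why-might-fail singles out — cannot be disposed of by
substitutions alone; the lines' "reflect and recombine to a zero integrand" uses (1a) at `0` and (1b).
[cite: KontsevichZagier2001, §1.2] -/
theorem false_without_additivity : ¬ (∀ c ∈ AddSubgroup.closure {d : KZ.FormalRep | ∃ (G : Polynomial ℚ) (q a₀ a₁ : ℚ) (r : KZ.IntegralRep 1), G.natDegree = 3 ∧ Squarefree (G.comp (Polynomial.X ^ 2)) ∧ 0 < Polynomial.aeval (q : ℝ) (G.comp (Polynomial.X ^ 2)) ∧ Bornology.IsBounded (connectedComponentIn {y : ℝ | 0 < Polynomial.aeval y (G.comp (Polynomial.X ^ 2))} (q : ℝ)) ∧ r.domain = {x | x 0 ∈ connectedComponentIn {y : ℝ | 0 < Polynomial.aeval y (G.comp (Polynomial.X ^ 2))} (q : ℝ)} ∧ Set.EqOn r.integrand (fun x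 => ((a₀ : ℝ) + (a₁ : ℝ) * x 0) / Real.sqrt (Polynomial.aeval (x 0) (G.comp (Polynomial.X ^ 2)))) r.domain ∧ d = KZ.of r}, KZ.eval c = 0 →
    c ∈ AddSubgroup.closure (KZ.changeOfVariablesRel ∪ KZ.newtonLeibnizRel)) := fun h => by
  obtain ⟨r, hd, hi⟩ := exists_repCentral
  have hmem := h _ (AddSubgroup.subset_closure (of_mem_central hd hi))
    (by rw [KZ.eval_of, value_central hd hi])
  have hk := KZ.closure_cov_nl_le_ker_coeffSum hmem
  rw [AddMonoidHom.mem_ker, KZ.coeffSum_of] at hk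
  exact one_ne_zero hk

/-- The window `{x | every coordinate < 0}` in each dimension (in dimension `1`: the half-line
`{x < 0}`) is measurable. [folklore] -/
theorem measurableSet_negWindow (n : ℕ) : MeasurableSet {x : Fin n → ℝ | ∀ i, x i < 0} := by
  have : {x : Fin n → ℝ | ∀ i, x i < 0} = ⋂ i, {x | x i < 0} := by ext x; simp
  rw [this]
  exact MeasurableSet.iInter fun i => measurableSet_lt (measurable_pi_apply i) measurable_const

/-- The restricted value of the mirror pair `[r₊] − [r₋]` over the window `{x < 0}` is
`−∫₂³ dx/√F₀`: `K₊` misses the window, `K₋` lies inside it. [folklore] -/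
theorem restrictedEval_pair {r r' : KZ.IntegralRep 1} (hd : r.domain = {p | p 0 ∈ Ioo (2:ℝ) 3})
    (hd' : r'.domain = {p | p 0 ∈ Ioo (-3:ℝ) (-2)}) (hi' : r'.integrand = fun p => 1 / Real.sqrt (-((p 0 ^ 2 - 1) * (p 0 ^ 2 - 4) * (p 0 ^ 2 - 9)))) :
    KZ.restrictedEval (fun n => {x : Fin n → ℝ | ∀ i, x i < 0}) (KZ.of r - KZ.of r') =
      -∫ x in Ioo (2:ℝ) 3, 1 / Real.sqrt (-((x ^ 2 - 1) * (x ^ 2 - 4) * (x ^ 2 - 9))) := by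
  rw [map_sub, KZ.restrictedEval_of, KZ.restrictedEval_of]
  have h1 : r.domain ∩ {x : Fin 1 → ℝ | ∀ i, x i < 0} = ∅ := by
    rw [hd]
    ext x
    simp only [mem_inter_iff, mem_setOf_eq, mem_Ioo, mem_empty_iff_false, iff_false, not_and, not_forall, not_lt]
    intro hx
    exact ⟨0, by linarith [hx.1]⟩
  have h2 : r'.domain ∩ {x : Fin 1 → ℝ | ∀ i, x i < 0} = r'.domain := by
    refine inter_eq_left.2 fun x hx i => ?_
    have hi0 : i = 0 := Subsingleton.elim i 0
    subst hi0
    rw [hd'] at hx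
    have hx' : x 0 ∈ Ioo (-3:ℝ) (-2) := hx
    linarith [hx'.2]
  rw [h1, h2, Measure.restrict_empty, integral_zero_measure, zero_sub, ← value_left hd' hi']
  rfl

/-- **Any proof must move mass across `x = 0`, i.e. use rule (2) or (3).** The crux with
`KZ.relations` replaced by the subgroup generated by the ADDITIVITY rules (1a) + (1b) alone is FALSE:
the mirror pair `[K₊, 1/√F₀] − [K₋, 1/√F₀]` has value `0` (evenness), but its restricted value over
the window `{x < 0}` is `−∫₂³ dx/√F₀ ≠ 0`, and `KZ.restrictedEval` kills (1a) + (1b)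
(`KZ.closure_add_le_ker_restrictedEval`). The cheapest honest derivation is ONE reflection move
`x ↦ −x` (rule (2)). [cite: KontsevichZagier2001, §1.2] -/
theorem false_without_cov_nl : ¬ (∀ c ∈ AddSubgroup.closure {d : KZ.FormalRep | ∃ (G : Polynomial ℚ) (q a₀ a₁ : ℚ) (r : KZ.IntegralRep 1), G.natDegree = 3 ∧ Squarefree (G.comp (Polynomial.X ^ 2)) ∧ 0 < Polynomial.aeval (q : ℝ) (G.comp (Polynomial.X ^ 2)) ∧ Bornology.IsBounded (connectedComponentIn {y : ℝ | 0 < Polynomial.aeval y (G.comp (Polynomial.X ^ 2))} (q : ℝ)) ∧ r.domain = {x | x 0 ∈ connectedComponentIn {y : ℝ | 0 < Polynomial.aeval y (G.comp (Polynomial.X ^ 2))} (q : ℝ)} ∧ Set.EqOn r.integrand (fun x => ((a₀ : ℝ) + (a₁ : ℝ) * x 0) / Real.sqrt (Polynomial.aeval (x 0) (G.comp (Polynomial.X ^ 2)))) r.domain ∧ d = KZ.of r}, KZ.eval c = 0 →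
    c ∈ AddSubgroup.closure (KZ.domainAddRel ∪ KZ.integrandAddRel)) := fun h => by
  obtain ⟨r, hd, hi⟩ := exists_repRight
  obtain ⟨r', hd', hi'⟩ := exists_repLeft
  have hc : KZ.of r - KZ.of r' ∈ AddSubgroup.closure {d : KZ.FormalRep | ∃ (G : Polynomial ℚ) (q a₀ a₁ : ℚ) (r : KZ.IntegralRep 1), G.natDegree = 3 ∧ Squarefree (G.comp (Polynomial.X ^ 2)) ∧ 0 < Polynomial.aeval (q : ℝ) (G.comp (Polynomial.X ^ 2)) ∧ Bornology.IsBounded (connectedComponentIn {y : ℝ | 0 < Polynomial.aeval y (G.comp (Polynomial.X ^ 2))} (q : ℝ)) ∧ r.domain = {x | x 0 ∈ connectedComponentIn {y : ℝ | 0 < Polynomial.aeval y (G.comp (Polynomial.X ^ 2))} (q : ℝ)} ∧ Set.EqOn r.integrand (fun x => ((a₀ : ℝ) + (a₁ : ℝ) * x 0) / Real.sqrt (Polynomial.aeval (x 0) (G.comp (Polynomial.X ^ 2)))) r.domain ∧ d = KZ.of r} :=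
    sub_mem (AddSubgroup.subset_closure (of_mem_right hd hi)) (AddSubgroup.subset_closure (of_mem_left hd' hi'))
  have h0 : KZ.eval (KZ.of r - KZ.of r') = 0 := by
    rw [map_sub, KZ.eval_of, KZ.eval_of, value_right hd hi, value_left hd' hi', sub_self]
  have hk := KZ.closure_add_le_ker_restrictedEval (fun n => {x : Fin n → ℝ | ∀ i, x i < 0})
    measurableSet_negWindow (h _ hc h0)
  rw [AddMonoidHom.mem_ker, restrictedEval_pair hd hd' hi', neg_eq_zero] at hk
  exact integral_right_pos.ne' hk

/-! ### §7 Refuted natural strengthenings: the kernel of the sector in its two shapes -/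

/-- **A non-degenerate generator CAN have value `0`.** The natural strengthening "every generator
`[K, (a₀+a₁x)/√G(x²)]` with `(a₀, a₁) ≠ (0,0)` has non-zero value" (which would make the sector's
kernel consist of combinations of DIFFERENCES of generators only) is FALSE: `[K₀, x/√F₀]` (`a₀ = 0`,
`a₁ = 1`) has value `0`. The hypotheses are the crux's generator clauses verbatim.
[cite: KontsevichZagier2001, §1.2] -/
theorem not_value_ne_zero_of_nondegenerate : ¬ (∀ (G : Polynomial ℚ) (q a₀ a₁ : ℚ) (r : KZ.IntegralRep 1),
    G.natDegree = 3 → Squarefree (G.comp (Polynomial.X ^ 2)) →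
    0 < Polynomial.aeval (q : ℝ) (G.comp (Polynomial.X ^ 2)) →
    Bornology.IsBounded (connectedComponentIn {y : ℝ | 0 < Polynomial.aeval y (G.comp (Polynomial.X ^ 2))} (q : ℝ)) →
    r.domain = {x | x 0 ∈ connectedComponentIn {y : ℝ | 0 < Polynomial.aeval y (G.comp (Polynomial.X ^ 2))} (q : ℝ)} →
    Set.EqOn r.integrand (fun x => ((a₀ : ℝ) + (a₁ : ℝ) * x 0) /
      Real.sqrt (Polynomial.aeval (x 0) (G.comp (Polynomial.X ^ 2)))) r.domain →
    (a₀ ≠ 0 ∨ a₁ ≠ 0) → r.value ≠ 0) := fun h => by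
  obtain ⟨r, hd, hi⟩ := exists_repCentral
  refine h (Polynomial.C (-1) * Polynomial.X ^ 3 + Polynomial.C 14 * Polynomial.X ^ 2 + Polynomial.C (-49) * Polynomial.X + Polynomial.C 36 : Polynomial ℚ) 0 0 1 r natDegree_G₀ squarefree_comp_G₀ (by rw [aeval_F₀]; norm_num)
    isBounded_component_central (by rw [component_central, hd])
    (fun x _ => by simp only [aeval_F₀, hi]; simp) (Or.inr one_ne_zero) (value_central hd hi)

/-- **A single generator in the kernel.** Some generator of the sector is a non-zero formal
combination (coefficient sum `1`) of value `0` whose integrand vanishes only at the centre `x = 0`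
of its oval — the through-zero shape of kernel element every line must digest (dissect at `0`,
reflect one half, recombine to the zero integrand). [cite: KontsevichZagier2001, §1.2] -/
theorem exists_kernel_single_ne_zero : ∃ r : KZ.IntegralRep 1, KZ.of r ∈ {d : KZ.FormalRep | ∃ (G : Polynomial ℚ) (q a₀ a₁ : ℚ) (r : KZ.IntegralRep 1), G.natDegree = 3 ∧ Squarefree (G.comp (Polynomial.X ^ 2)) ∧ 0 < Polynomial.aeval (q : ℝ) (G.comp (Polynomial.X ^ 2)) ∧ Bornology.IsBounded (connectedComponentIn {y : ℝ | 0 < Polynomial.aeval y (G.comp (Polynomial.X ^ 2))} (q : ℝ)) ∧ r.domain = {x | x 0 ∈ connectedComponentIn {y : ℝ | 0 < Polynomial.aeval y (G.comp (Polynomial.X ^ 2))} (q : ℝ)} ∧ Set.EqOn r.integrand (fun x => ((a₀ : ℝ) + (a₁ : ℝ) * x 0) / Real.sqrt (Polynomial.aeval (x 0) (G.comp (Polynomial.X ^ 2)))) r.domain ∧ d = KZ.of r} ∧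
    KZ.eval (KZ.of r) = 0 ∧ KZ.of r ≠ 0 ∧ (∀ x ∈ r.domain, x 0 ≠ 0 → r.integrand x ≠ 0) := by
  obtain ⟨r, hd, hi⟩ := exists_repCentral
  refine ⟨r, of_mem_central hd hi, by rw [KZ.eval_of, value_central hd hi], fun h0 => ?_,
    fun x hx hx0 => ?_⟩
  · have := congrArg KZ.coeffSum h0
    rw [KZ.coeffSum_of, map_zero] at this
    exact one_ne_zero this
  · rw [hd] at hx
    have hx' : x 0 ∈ Ioo (-1:ℝ) 1 := hx
    rw [hi]
    exact div_ne_zero hx0 (Real.sqrt_pos.mpr (sextic_pos_central hx')).ne'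

/-- **A mirror pair in the kernel.** Some difference of two generators of the sector has value `0`,
is a non-zero formal combination, and lies OUTSIDE the additive sub-calculus `closure((1a) ∪ (1b))`
(its restricted value over `{x < 0}` is `−∫₂³ dx/√F₀ ≠ 0`) — the off-zero shape of kernel element
(one reflection move). [cite: KontsevichZagier2001, §1.2] -/
theorem exists_kernel_pair_ne_zero : ∃ c ∈ AddSubgroup.closure {d : KZ.FormalRep | ∃ (G : Polynomial ℚ) (q a₀ a₁ : ℚ) (r : KZ.IntegralRep 1), G.natDegree = 3 ∧ Squarefree (G.comp (Polynomial.X ^ 2)) ∧ 0 < Polynomial.aeval (q : ℝ) (G.comp (Polynomial.X ^ 2)) ∧ Bornology.IsBounded (connectedComponentIn {y : ℝ | 0 < Polynomial.aeval y (G.comp (Polynomial.X ^ 2))} (q : ℝ)) ∧ r.domain = {x | x 0 ∈ connectedComponentIn {y : ℝ | 0 < Polynomial.aeval y (G.comp (Polynomial.X ^ 2))} (q : ℝ)} ∧ Set.EqOn r.integrand (fun x => ((a₀ : ℝ) + (a₁ : ℝ) * x 0) / Real.sqrt (Polynomial.aeval (x 0) (G.comp (Polynomial.X ^ 2)))) r.domain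 ∧ d = KZ.of r}, KZ.eval c = 0 ∧ c ≠ 0 ∧
    c ∉ AddSubgroup.closure (KZ.domainAddRel ∪ KZ.integrandAddRel) := by
  obtain ⟨r, hd, hi⟩ := exists_repRight
  obtain ⟨r', hd', hi'⟩ := exists_repLeft
  refine ⟨KZ.of r - KZ.of r',
    sub_mem (AddSubgroup.subset_closure (of_mem_right hd hi)) (AddSubgroup.subset_closure (of_mem_left hd' hi')),
    by rw [map_sub, KZ.eval_of, KZ.eval_of, value_right hd hi, value_left hd' hi', sub_self],
    fun h0 => ?_, fun hmem => ?_⟩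
  · have := congrArg (KZ.restrictedEval (fun n => {x : Fin n → ℝ | ∀ i, x i < 0})) h0
    rw [restrictedEval_pair hd hd' hi', map_zero, neg_eq_zero] at this
    exact integral_right_pos.ne' this
  · have hk := KZ.closure_add_le_ker_restrictedEval (fun n => {x : Fin n → ℝ | ∀ i, x i < 0})
      measurableSet_negWindow hmem
    rw [AddMonoidHom.mem_ker, restrictedEval_pair hd hd' hi', neg_eq_zero] at hk
    exact integral_right_pos.ne' hk

end Summit.KontsevichZagierPeriods.IsogenyCertificates.BiellipticRealPeriodCellNegative
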